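import Summits.FinalStateConjecture.FinalStateConjecture.Theses.BartnikGapSettling
import Summits.FinalStateConjecture.FinalStateConjecture.Theorems.BartnikGapSettlingSettledCaptureStubVisibleRaysStay
import Summits.FinalStateConjecture.FinalStateConjecture.Theorems.SettledCapture.Negative.TypedNormalForm
import Summits.FinalStateConjecture.FinalStateConjecture.Theorems.SettledCapture.Negative.SoundRetype

/-!
# Line `tendril-swarm-rays` — checked skeleton for crux `SettledCapture` (stmt-FinalStateConjecture-17328)
# of route `BartnikGapSettling` — file `Cruxes/SettledCapture/Lines/tendril-swarm-rays.lean`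

crux-plan seat `planner-cruxplan-stmt-FinalStateConjecture-17328-tendril-swarm-rays-0`, 2026-08-17,
from crux idea `Ideas/tendril-swarm-rays.md` (ideator 2, r1; triage r1-1 / r1-2 / r1-3: pass ×3) — line
card `Lines/tendril-swarm-rays.md`.

## The cut (four registered stubs + the kernel-checked composition `SettledCapture_of`)

`SettledCapture` = `∀ admissible D, ∀ MGHD 𝒟, complete 𝓘⁺ → LeafHyp 𝒟 → T2Conclusion 𝒟`
(`Negative/TypedNormalForm.settledCapture_iff`, `Iff.rfl`). The T2 conclusion asks for an EXTERIOR
decomposition `(O, d)` (sub-extremal holes, `O = exteriorOf 𝒟 d.charted`, `HasExhaustiveCharts d`,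
`IsFutureOriented d`) satisfying moreover the intrinsic lower bound `RaysStayInClosure 𝒟 O` (every
future-complete normalised null ray from `Σ` stays in `closure O`). The idea's lever: the rays clause
is a CHARTABILITY statement — `FinalStateDecomposition.flatDomain : Opens E4` is only bounded BELOW
(`setOf_lt_excision_subset_flatDomain`), so a countable SWARM of `δⱼ`-flat TENDRILS (extra components
of the flat domain, placed in the coordinate room of an excision tube, mapped into the expanding /
decurving regions the exterior charts never see, with causally cofinal roots) can be GRAFTED onto an
exterior decomposition, after which the rays clause holds for the enlarged
`O' = J⁺(ιΣ) ∩ I⁻(d.charted ∪ tendrils)`.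

* `stub_leavesAreSound` — TYPED LEAVES ARE SOUND: `LeafHyp 𝒟 → SoundLeafHyp 𝒟` (the sound block of
  `Negative/SoundRetype.lean`, p153807). This ONE implication is the item's recorded misstatement,
  isolated: under THE DODGE (`leafHyp_minkowski` p146299 + paper transport: typed `IsNearKerrLeaf` is
  met by 0-hole boost-stretched TIMELIKE sheets in every complete-`𝓘⁺` development) `LeafHyp` is idle
  while `SoundLeafHyp` (achronal sheets, honest discs, layer certification) is not, so the stub is
  PAPER-FALSE wherever the sound margin fails (extremal-Kerr end states, Kehle–Unger) and TRUE at the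
  certified Minkowski column (`soundLeafHyp_minkowski`). It is DEAD AS TYPED by design: it is exactly
  what disappears when the planner re-types the item over sound leaves (`SoundSettledCapture`: the
  hypothesis becomes `SoundLeafHyp 𝒟` and `SettledCapture_of` below loses its first binder, nothing
  else). No lead should drive it (PICKED.md c1 stands); it is registered so that the line's death
  certificate on the typed item is one line long and names the repair.
* `stub_soundExteriorCaptureWithRoom` — SOUND EXTERIOR CAPTURE, NORMALISED (the exterior GR input, live
  for the re-type; `N ≤ 1`: sub-extremal Kerr stability from sound interior hyperboloidal leaves,
  `N ≥ 2`: multi-Kerr capture): sound near-sub-extremal-Kerr leaves beyond every compact set ⇒ an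
  exterior decomposition `(O, d)` with the four exterior clauses which EITHER already certifies the
  rays cofinally SUB-CHARTED (every complete ray returns to `closure O` beyond every parameter — the
  only option at `N = 0`, dispersal, where the flat chart fills `{x⁰ > τ₀}` and there is no coordinate
  room; weaker than birth v2's `closure d.charted`) OR leaves VERTICAL COORDINATE ROOM for tendrils: an
  open cylinder `{τ₀ - 1 < x⁰, ‖x̲ - c̲‖ < w}` of `E4` disjoint from `d.flatDomain` (honest witness with
  `N ≥ 1`: put the flat frame at rest with respect to one hole — a global orthochronous Poincaré
  re-gauging of `d` — and take a thin cylinder inside its excision tube; triage r1-1 (i) / r1-3 (i):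
  the `N ≥ 1` / room proviso made explicit instead of being discovered false at `N = 0`).
* `stub_completeRaysShadowed` — COMPLETE RAYS ARE SHADOWED (GR residual; the hardest genuine stub;
  leaf-free): in a complete-`𝓘⁺` MGHD of an admissible datum, for EVERY exterior decomposition
  `(O, d)`: EITHER every complete ray is cofinally sub-charted (`closure O`), OR there is a TENDRIL
  SWARM — countably many smooth open embeddings `Φⱼ` of the standard boxes `(-1, hⱼ) × B³(0, 1) ⊆ E4`,
  `hⱼ → ∞`, rooted in `J⁺(ιΣ)`, with full `C²` deviation from `η` at most `δⱼ → 0`, future-oriented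
  with margin (`Φⱼ₊V` future-directed for constant `V` with `2‖V̲‖ ≤ V⁰`, `V⁰ > 0`), chronological inside
  each box with margin (`2‖y̲ - x̲‖ < y⁰ - x⁰ ⇒ Φⱼ y ∈ I⁺(Φⱼ x)`), pairwise disjoint, off
  `d.radiationZone`, with CAUSALLY COFINAL ROOTS (every point of `I⁻(swarm)` lies in `J⁻` of the root
  `Φⱼ(0)` of boxes of arbitrarily large index) — in the closure of whose enlarged exterior
  `exteriorOf 𝒟 (d.charted ∪ swarm)` every future-complete normalised null ray from `Σ` lies
  cofinally. This is the triage-sharpened form of the card's `InvisibleRaysNeedleChartable`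
  (r1-2: sizeless needles AT ray points are too weak — here complete boxes whose chronological PASTS
  do the work, roots causally cofinal; r1-1 (1): countable causal cofinality is part of the statement;
  r1-1 (2): no `N ≥ 1` assumption needed HERE — room is `stub_swarmGrafting`'s business). Content = the CURVATURE-FATE
  DICHOTOMY: complete rays are shadowed by charted or DECURVING futures — rays to `𝓘⁺` and horizon
  generators by the far radiation zone, pocket rays (AF end # expanding closed hyperbolic pocket,
  `Theses/PocketUniverses.lean`, stmt-18854) by late pocket tendrils (`|Rm| ≲ t⁻²` along CMC/Gauss
  time: Anderson CMP 222 (2001), Lott AHP 19 (2018), Andersson–Moncrief gr-qc/0303045, Reiris AHP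
  2010), black holes INSIDE pockets by the closure — while CRUSHING regions (sub-extremal hole
  interiors) carry no complete ray at all (card `null-concave-crush`: `exit_of_weightedConcave` LANDED
  p153671; exact Kerr: `KerrBlackHoleNoCompleteNullRay_holds`). Universal quantification over `(O, d)`
  is SAFE here (unlike birth's `stub_raysEventuallyVisible` / stmt-17673, pocket-false): a perverse or
  undercutting `d` only enlarges the set of rays the swarm must shadow, `d.charted ⊆ O` always helps,
  and only `d.radiationZone` must be avoided.
* `stub_swarmGrafting` — SWARM GRAFTING (Lorentzian bookkeeping, provable now, L; leaf-free,
  dynamics-free): exterior decomposition + vertical room + tendril swarm ⇒ a decomposition `d'` of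
  some `O' ⊇ O` with the same holes satisfying ALL FIVE T2 clauses: thin the boxes to pairwise disjoint
  sub-cylinders of the room (disc packing), translate box `j` so that its root sits at flat level `τ₀`
  (roots on the certified `τ₀`-slab; box `j` occupies levels `(τ₀ - 1, τ₀ + hⱼ)`), glue
  `flatChart ⊔ ⨆ⱼ Φⱼ` on `flatDomain ∪ ⋃ⱼ Qⱼ'` (one open embedding of the late region: late images
  pairwise disjoint), `deviationCk → 0` (level `τ` meets box `j` only if `τ < τ₀ + hⱼ`; `δⱼ → 0`;
  locality of `iteratedFDeriv`), `diff_subset_causalPast` / `HasExhaustiveCharts` (ii) from root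
  cofinality + in-box chronology (`Φⱼ(0) ≪ Φⱼ(τ₁ - τ₀, 0)`), `IsFutureOriented` (iii) from the
  orientation clause at `V = e₀`, `O ⊆ O'` by monotonicity of `I⁻`, and `RaysStayInClosure O'` from the
  shadow clause (`I⁻(thick swarm) ⊆ I⁻(thin late swarm)` by roots + margin, then push-up along rays for
  the past set `I⁻(d'.charted)` — the argument of `raysStay_of_le_of_mem_closure` below).

`SettledCapture_of` (sorry-free): stub 1 (`stub_leavesAreSound`) upgrades the leaves, stub 2
(`stub_soundExteriorCaptureWithRoom`) gives `(O, d)`; in the SUB-CHARTED cases the in-file causal lemma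
`raysStay_of_le_of_mem_closure` (the landed `stub_visibleRaysStay`, p149576, re-targeted at `closure O`)
yields `RaysStayInClosure 𝒟 O`; otherwise stub 2 leaves room, stub 3 (`stub_completeRaysShadowed`) supplies
the swarm and stub 4 (`stub_swarmGrafting`) grafts it. Numbering 1–4 = the order of the binders of
`SettledCapture_of` = the order used in the line card.

Disproof used: NONE EXISTS for this crux (payload `disproof_path` absent on disk; `Cruxes/SettledCapture/`
has no `Disproof.lean`, 2026-08-17T12:1xZ). Landed Negative lemmas honoured (all imported here):
`TypedNormalForm` (`settledCapture_iff`, `leafHyp_minkowski`, `t2Conclusion_minkowski`),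
`SoundRetype` (`SoundLeafHyp`, `soundLeafHyp_minkowski`), `InheritsCapture` (stubs 1+2 together still
contain `QuietWindowCapture.Capture`, as every positive line on the typed item must). Minkowski column:
stub 1 holds (`soundLeafHyp_minkowski`), stub 2 with the SUB-CHARTED disjunct (honest `N = 0` flat chart
on all of `E4`), stub 3 with its first disjunct, stub 4 is never invoked. `ledger negatives`: 1 entry
(¬UniformPhotonSphereChannels), unrelated — no stub is an instance of a refuted statement.
-/

set_option linter.dupNamespace false

noncomputable section

namespace Summit.FinalStateConjecture.FinalStateConjecture.Cruxes.SettledCapture.TendrilSwarmRays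

open scoped BigOperators Topology Manifold Classical ENNReal ContDiff
open Filter Set Function TopologicalSpace
open Literature.Geometry.Lorentzian
open Summit.FinalStateConjecture.FinalStateConjecture.Theorems
open Summit.FinalStateConjecture.FinalStateConjecture.Theorems.SettledCapture.Negative
open Summit.FinalStateConjecture.FinalStateConjecture.Theorems.SettledCapture.Retype

/-! ## Statements of the four stubs as named propositions (the skeleton audit reads the hypotheses of
`SettledCapture_of` BY NAME: each head must be a declared stub, whence the `Goal.stub_*` abbreviations). -/

/-- Statement of `stub_leavesAreSound` (THE ISOLATED MISSTATEMENT: typed leaves ⇒ sound leaves). -/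
def LeavesAreSound : Prop := ∀ (X : Type) [TopologicalSpace X] [ChartedSpace E3 X] [IsManifold (𝓡 3) ((⊤ : ℕ∞) : WithTop ℕ∞) X] [T2Space X] [SecondCountableTopology X] [ConnectedSpace X], ∀ D ∈ admissibleVacuumData X, ∀ 𝒟 : VacuumCauchyDevelopment D, 𝒟.IsMaximal → Summit.FinalStateConjecture.HasCompleteNullInfinity 𝒟.toCauchyDevelopment → LeafHyp 𝒟 → SoundLeafHyp 𝒟

/-- Statement of `stub_soundExteriorCaptureWithRoom` (SOUND EXTERIOR CAPTURE, NORMALISED: rays cofinally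
sub-charted OR vertical coordinate room). -/
def SoundExteriorCaptureWithRoom : Prop := ∀ (X : Type) [TopologicalSpace X] [ChartedSpace E3 X] [IsManifold (𝓡 3) ((⊤ : ℕ∞) : WithTop ℕ∞) X] [T2Space X] [SecondCountableTopology X] [ConnectedSpace X], ∀ D ∈ admissibleVacuumData X, ∀ 𝒟 : VacuumCauchyDevelopment D, 𝒟.IsMaximal → Summit.FinalStateConjecture.HasCompleteNullInfinity 𝒟.toCauchyDevelopment → SoundLeafHyp 𝒟 → ∃ (O : Set 𝒟.carrier) (d : FinalStateDecomposition 𝒟.toSpacetime O 2), (∀ i, Kerr.IsSubextremal (d.mass i) (d.spin i)) ∧ O = Summit.FinalStateConjecture.exteriorOf 𝒟.toCauchyDevelopment d.charted ∧ Summit.FinalStateConjecture.HasExhaustiveCharts d ∧ Summit.FinalStateConjecture.IsFutureOriented d ∧ ((∀ [𝒟.metric.HasLeviCivita], ∀ (p : X) (γ : ℝ → 𝒟.carrier) (dom : Set ℝ), 𝒟.metric.IsNormalisedNullRayFrom 𝒟.timeOrientation 𝒟.embed 𝒟.normal p γ dom → ¬ BddAbove dom → ∀ t ∈ dom, ∃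 t' ∈ dom, t ≤ t' ∧ γ t' ∈ closure O) ∨ (∃ (c : E4) (w : ℝ), 0 < w ∧ Disjoint {x : E4 | d.τ₀ - 1 < x 0 ∧ E4.spatialNorm (x - c) < w} (d.flatDomain : Set E4)))

/-- Statement of `stub_completeRaysShadowed` (GR residual: rays cofinally sub-charted, or a flat tendril
swarm shadowing every future-complete null ray from `Σ`). -/
def CompleteRaysShadowed : Prop := ∀ (X : Type) [TopologicalSpace X] [ChartedSpace E3 X] [IsManifold (𝓡 3) ((⊤ : ℕ∞) : WithTop ℕ∞) X] [T2Space X] [SecondCountableTopology X] [ConnectedSpace X], ∀ D ∈ admissibleVacuumData X, ∀ 𝒟 : VacuumCauchyDevelopment D, 𝒟.IsMaximal → Summit.FinalStateConjecture.HasCompleteNullInfinity 𝒟.toCauchyDevelopment → ∀ (O : Set 𝒟.carrier) (d : FinalStateDecomposition 𝒟.toSpacetime O 2), (∀ i, Kerr.IsSubextremal (d.mass i) (d.spin i)) → O = Summit.FinalStateConjecture.exteriorOf 𝒟.toCauchyDevelopment d.charted → Summit.FinalStateConjecture.HasExhaustiveCharts d → Summit.FinalStateConjecture.IsFutureOriented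 d → (∀ [𝒟.metric.HasLeviCivita], ∀ (p : X) (γ : ℝ → 𝒟.carrier) (dom : Set ℝ), 𝒟.metric.IsNormalisedNullRayFrom 𝒟.timeOrientation 𝒟.embed 𝒟.normal p γ dom → ¬ BddAbove dom → ∀ t ∈ dom, ∃ t' ∈ dom, t ≤ t' ∧ γ t' ∈ closure O) ∨ ∃ (h : ℕ → ℝ) (δ : ℕ → ENNReal) (Q : ℕ → TopologicalSpace.Opens E4) (Φ : ∀ j, Q j → 𝒟.carrier), (∀ j, (Q j : Set E4) = {x : E4 | -1 < x 0 ∧ x 0 < h j ∧ E4.spatialNorm x < 1}) ∧ Filter.Tendsto h Filter.atTop Filter.atTop ∧ Filter.Tendsto δ Filter.atTop (nhds 0) ∧ (∀ j, ContMDiff 𝓘(ℝ, E4) (𝓡 4) ((⊤ : ℕ∞) : WithTop ℕ∞) (Φ j) ∧ Topology.IsOpenEmbedding (Φ j)) ∧ (∀ j, Set.range (Φ j) ⊆ 𝒟.metric.causalFuture 𝒟.timeOrientation (Set.range 𝒟.embed)) ∧ (∀ j (τ : ℝ), 𝒟.toSpacetime.deviationCk (Minkowski.backgroundOn (Q j))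 (Φ j) 2 τ ≤ δ j) ∧ (∀ j (x : Q j) (V : E4), 2 * E4.spatialNorm V ≤ V 0 → 0 < V 0 → 𝒟.timeOrientation.IsFutureDirected (mfderiv 𝓘(ℝ, E4) (𝓡 4) (Φ j) x V)) ∧ (∀ j (x y : Q j), 2 * E4.spatialNorm (y.1 - x.1) < y.1 0 - x.1 0 → Φ j y ∈ 𝒟.metric.chronologicalFuture 𝒟.timeOrientation {Φ j x}) ∧ Pairwise (Function.onFun Disjoint fun j => Set.range (Φ j)) ∧ (∀ j, Disjoint (Set.range (Φ j)) d.radiationZone) ∧ (∀ w ∈ 𝒟.metric.chronologicalPast 𝒟.timeOrientation (⋃ j, Set.range (Φ j)), ∀ j₀ : ℕ, ∃ j, j₀ ≤ j ∧ w ∈ 𝒟.metric.causalPast 𝒟.timeOrientation (Φ j '' {x | x.1 = 0})) ∧ (∀ [𝒟.metric.HasLeviCivita], ∀ (p : X) (γ : ℝ → 𝒟.carrier) (dom : Set ℝ), 𝒟.metric.IsNormalisedNullRayFrom 𝒟.timeOrientation 𝒟.embed 𝒟.normal p γ dom → ¬ BddAbove dom → ∀ t ∈ dom, ∃ t' ∈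 dom, t ≤ t' ∧ γ t' ∈ closure (Summit.FinalStateConjecture.exteriorOf 𝒟.toCauchyDevelopment (d.charted ∪ ⋃ j, Set.range (Φ j))))

/-- Statement of `stub_swarmGrafting` (bookkeeping: exterior decomposition + room + swarm ⇒ the five T2
clauses for an enlarged exterior with the same holes). -/
def SwarmGrafting : Prop := ∀ (X : Type) [TopologicalSpace X] [ChartedSpace E3 X] [IsManifold (𝓡 3) ((⊤ : ℕ∞) : WithTop ℕ∞) X] [T2Space X] [SecondCountableTopology X] [ConnectedSpace X], ∀ (D : InitialDataSet (𝓡 3) X) (𝒟 : VacuumCauchyDevelopment D), ∀ (O : Set 𝒟.carrier) (d : FinalStateDecomposition 𝒟.toSpacetime O 2), (∀ i, Kerr.IsSubextremal (d.mass i) (d.spin i)) → O = Summit.FinalStateConjecture.exteriorOf 𝒟.toCauchyDevelopment d.charted → Summit.FinalStateConjecture.HasExhaustiveCharts d → Summit.FinalStateConjecture.IsFutureOriented d → ∀ (c : E4) (w : ℝ), 0 < w → Disjoint {x : E4 | d.τ₀ - 1 < x 0 ∧ E4.spatialNorm (x - c) < w} (d.flatDomain : Set E4) → ∀ (h : ℕ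 → ℝ) (δ : ℕ → ENNReal) (Q : ℕ → TopologicalSpace.Opens E4) (Φ : ∀ j, Q j → 𝒟.carrier), (∀ j, (Q j : Set E4) = {x : E4 | -1 < x 0 ∧ x 0 < h j ∧ E4.spatialNorm x < 1}) → Filter.Tendsto h Filter.atTop Filter.atTop → Filter.Tendsto δ Filter.atTop (nhds 0) → (∀ j, ContMDiff 𝓘(ℝ, E4) (𝓡 4) ((⊤ : ℕ∞) : WithTop ℕ∞) (Φ j) ∧ Topology.IsOpenEmbedding (Φ j)) → (∀ j, Set.range (Φ j) ⊆ 𝒟.metric.causalFuture 𝒟.timeOrientation (Set.range 𝒟.embed)) → (∀ j (τ : ℝ), 𝒟.toSpacetime.deviationCk (Minkowski.backgroundOn (Q j)) (Φ j) 2 τ ≤ δ j) → (∀ j (x : Q j) (V : E4), 2 * E4.spatialNorm V ≤ V 0 → 0 < V 0 → 𝒟.timeOrientation.IsFutureDirected (mfderiv 𝓘(ℝ, E4) (𝓡 4) (Φ j) x V)) → (∀ j (x y : Q j), 2 * E4.spatialNorm (y.1 - x.1) < y.1 0 - x.1 0 → Φ j y ∈ 𝒟.metric.chronologicalFuture 𝒟.timeOrientation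 {Φ j x}) → Pairwise (Function.onFun Disjoint fun j => Set.range (Φ j)) → (∀ j, Disjoint (Set.range (Φ j)) d.radiationZone) → (∀ w ∈ 𝒟.metric.chronologicalPast 𝒟.timeOrientation (⋃ j, Set.range (Φ j)), ∀ j₀ : ℕ, ∃ j, j₀ ≤ j ∧ w ∈ 𝒟.metric.causalPast 𝒟.timeOrientation (Φ j '' {x | x.1 = 0})) → (∀ [𝒟.metric.HasLeviCivita], ∀ (p : X) (γ : ℝ → 𝒟.carrier) (dom : Set ℝ), 𝒟.metric.IsNormalisedNullRayFrom 𝒟.timeOrientation 𝒟.embed 𝒟.normal p γ dom → ¬ BddAbove dom → ∀ t ∈ dom, ∃ t' ∈ dom, t ≤ t' ∧ γ t' ∈ closure (Summit.FinalStateConjecture.exteriorOf 𝒟.toCauchyDevelopment (d.charted ∪ ⋃ j, Set.range (Φ j)))) → ∃ (O' : Set 𝒟.carrier) (d' : FinalStateDecomposition 𝒟.toSpacetime O' 2), O ⊆ O' ∧ d'.N = d.N ∧ (∀ i, Kerr.IsSubextremal (d'.mass i) (d'.spin i)) ∧ O' = Summit.FinalStateConjecture.exteriorOf 𝒟.toCauchyDevelopment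 d'.charted ∧ Summit.FinalStateConjecture.RaysStayInClosure 𝒟.toCauchyDevelopment O' ∧ Summit.FinalStateConjecture.HasExhaustiveCharts d' ∧ Summit.FinalStateConjecture.IsFutureOriented d'

namespace Goal
/-- Statement of `stub_leavesAreSound`, under the stub's name. -/
abbrev stub_leavesAreSound : Prop := LeavesAreSound
/-- Statement of `stub_soundExteriorCaptureWithRoom`, under the stub's name. -/
abbrev stub_soundExteriorCaptureWithRoom : Prop := SoundExteriorCaptureWithRoom
/-- Statement of `stub_completeRaysShadowed`, under the stub's name. -/
abbrev stub_completeRaysShadowed : Prop := CompleteRaysShadowed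
/-- Statement of `stub_swarmGrafting`, under the stub's name. -/
abbrev stub_swarmGrafting : Prop := SwarmGrafting
end Goal

/-! ## Registered stubs, stated expanded (the only `sorry`s of the file) -/

/-- stub 1 — TYPED LEAVES ARE SOUND (DEAD AS TYPED BY DESIGN: the item's misstatement, isolated; vanishes
under the sound re-type; do not drive): in a complete-`𝓘⁺` MGHD of an admissible datum, the crux's typed
leaf block implies the sound leaf block of `Negative/SoundRetype.lean`. -/
theorem stub_leavesAreSound : ∀ (X : Type) [TopologicalSpace X] [ChartedSpace E3 X] [IsManifold (𝓡 3) ((⊤ : ℕ∞) : WithTop ℕ∞) X] [T2Space X] [SecondCountableTopology X] [ConnectedSpace X], ∀ D ∈ admissibleVacuumData X, ∀ 𝒟 : VacuumCauchyDevelopment D, 𝒟.IsMaximal → Summit.FinalStateConjecture.HasCompleteNullInfinity 𝒟.toCauchyDevelopment → LeafHyp 𝒟 → SoundLeafHyp 𝒟 := by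
  sorry

/-- stub 2 — SOUND EXTERIOR CAPTURE WITH ROOM (exterior GR; live for the re-type): sound
near-sub-extremal-Kerr leaves beyond every compact set ⇒ `(O, d)` with sub-extremal holes,
`O = exteriorOf 𝒟 d.charted`, exhaustive honest charts, future-oriented chart times, and EITHER every
future-complete normalised null ray from `Σ` cofinally in `closure O` OR an open vertical coordinate
cylinder `{τ₀ - 1 < x⁰, ‖x̲ - c̲‖ < w}` disjoint from `d.flatDomain`. -/
theorem stub_soundExteriorCaptureWithRoom : ∀ (X : Type) [TopologicalSpace X] [ChartedSpace E3 X] [IsManifold (𝓡 3) ((⊤ : ℕ∞) : WithTop ℕ∞) X] [T2Space X] [SecondCountableTopology X] [ConnectedSpace X], ∀ D ∈ admissibleVacuumData X, ∀ 𝒟 : VacuumCauchyDevelopment D, 𝒟.IsMaximal → Summit.FinalStateConjecture.HasCompleteNullInfinity 𝒟.toCauchyDevelopment → SoundLeafHyp 𝒟 → ∃ (O : Set 𝒟.carrier) (d : FinalStateDecomposition 𝒟.toSpacetime O 2), (∀ i, Kerr.IsSubextremal (d.mass i) (d.spin i)) ∧ O = Summit.FinalStateConjecture.exteriorOf 𝒟.toCauchyDevelopment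 d.charted ∧ Summit.FinalStateConjecture.HasExhaustiveCharts d ∧ Summit.FinalStateConjecture.IsFutureOriented d ∧ ((∀ [𝒟.metric.HasLeviCivita], ∀ (p : X) (γ : ℝ → 𝒟.carrier) (dom : Set ℝ), 𝒟.metric.IsNormalisedNullRayFrom 𝒟.timeOrientation 𝒟.embed 𝒟.normal p γ dom → ¬ BddAbove dom → ∀ t ∈ dom, ∃ t' ∈ dom, t ≤ t' ∧ γ t' ∈ closure O) ∨ (∃ (c : E4) (w : ℝ), 0 < w ∧ Disjoint {x : E4 | d.τ₀ - 1 < x 0 ∧ E4.spatialNorm (x - c) < w} (d.flatDomain : Set E4))) := by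
  sorry

/-- stub 3 — COMPLETE RAYS ARE SHADOWED (GR residual, hardest genuine stub; leaf-free): for every exterior
decomposition of a complete-`𝓘⁺` MGHD of an admissible datum, either every complete ray is cofinally in
`closure O`, or a flat TENDRIL SWARM exists (standard boxes `(-1, hⱼ) × B³(0, 1)`, `hⱼ → ∞`,
`C²`-deviation `≤ δⱼ → 0`, rooted in `J⁺(ιΣ)`, future-oriented and chronological with margin `1/2`,
pairwise disjoint, off the radiation zone, roots causally cofinal) in the closure of whose enlarged
exterior `exteriorOf 𝒟 (d.charted ∪ swarm)` every future-complete normalised null ray from `Σ` lies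
cofinally. Curvature-fate dichotomy: charted or decurving futures shadow every complete ray; crushing
regions carry none. -/
theorem stub_completeRaysShadowed : ∀ (X : Type) [TopologicalSpace X] [ChartedSpace E3 X] [IsManifold (𝓡 3) ((⊤ : ℕ∞) : WithTop ℕ∞) X] [T2Space X] [SecondCountableTopology X] [ConnectedSpace X], ∀ D ∈ admissibleVacuumData X, ∀ 𝒟 : VacuumCauchyDevelopment D, 𝒟.IsMaximal → Summit.FinalStateConjecture.HasCompleteNullInfinity 𝒟.toCauchyDevelopment → ∀ (O : Set 𝒟.carrier) (d : FinalStateDecomposition 𝒟.toSpacetime O 2), (∀ i, Kerr.IsSubextremal (d.mass i) (d.spin i)) → O = Summit.FinalStateConjecture.exteriorOf 𝒟.toCauchyDevelopment d.charted → Summit.FinalStateConjecture.HasExhaustiveCharts d → Summit.FinalStateConjecture.IsFutureOriented d → (∀ [𝒟.metric.HasLeviCivita], ∀ (p : X) (γ : ℝ → 𝒟.carrier) (dom : Set ℝ), 𝒟.metric.IsNormalisedNullRayFrom 𝒟.timeOrientation 𝒟.embed 𝒟.normal p γ dom → ¬ BddAbove dom → ∀ t ∈ dom, ∃ t' ∈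 dom, t ≤ t' ∧ γ t' ∈ closure O) ∨ ∃ (h : ℕ → ℝ) (δ : ℕ → ENNReal) (Q : ℕ → TopologicalSpace.Opens E4) (Φ : ∀ j, Q j → 𝒟.carrier), (∀ j, (Q j : Set E4) = {x : E4 | -1 < x 0 ∧ x 0 < h j ∧ E4.spatialNorm x < 1}) ∧ Filter.Tendsto h Filter.atTop Filter.atTop ∧ Filter.Tendsto δ Filter.atTop (nhds 0) ∧ (∀ j, ContMDiff 𝓘(ℝ, E4) (𝓡 4) ((⊤ : ℕ∞) : WithTop ℕ∞) (Φ j) ∧ Topology.IsOpenEmbedding (Φ j)) ∧ (∀ j, Set.range (Φ j) ⊆ 𝒟.metric.causalFuture 𝒟.timeOrientation (Set.range 𝒟.embed)) ∧ (∀ j (τ : ℝ), 𝒟.toSpacetime.deviationCk (Minkowski.backgroundOn (Q j)) (Φ j) 2 τ ≤ δ j) ∧ (∀ j (x : Q j) (V : E4), 2 * E4.spatialNorm V ≤ V 0 → 0 < V 0 → 𝒟.timeOrientation.IsFutureDirected (mfderiv 𝓘(ℝ, E4) (𝓡 4) (Φ j) x V)) ∧ (∀ j (x y : Q j), 2 *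 E4.spatialNorm (y.1 - x.1) < y.1 0 - x.1 0 → Φ j y ∈ 𝒟.metric.chronologicalFuture 𝒟.timeOrientation {Φ j x}) ∧ Pairwise (Function.onFun Disjoint fun j => Set.range (Φ j)) ∧ (∀ j, Disjoint (Set.range (Φ j)) d.radiationZone) ∧ (∀ w ∈ 𝒟.metric.chronologicalPast 𝒟.timeOrientation (⋃ j, Set.range (Φ j)), ∀ j₀ : ℕ, ∃ j, j₀ ≤ j ∧ w ∈ 𝒟.metric.causalPast 𝒟.timeOrientation (Φ j '' {x | x.1 = 0})) ∧ (∀ [𝒟.metric.HasLeviCivita], ∀ (p : X) (γ : ℝ → 𝒟.carrier) (dom : Set ℝ), 𝒟.metric.IsNormalisedNullRayFrom 𝒟.timeOrientation 𝒟.embed 𝒟.normal p γ dom → ¬ BddAbove dom → ∀ t ∈ dom, ∃ t' ∈ dom, t ≤ t' ∧ γ t' ∈ closure (Summit.FinalStateConjecture.exteriorOf 𝒟.toCauchyDevelopment (d.charted ∪ ⋃ j, Set.range (Φ j)))) := by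
  sorry

/-- stub 4 — SWARM GRAFTING (Lorentzian bookkeeping, provable now; leaf-free, dynamics-free): an exterior
decomposition `(O, d)` with the four exterior clauses, a vertical coordinate cylinder disjoint from
`d.flatDomain`, and a tendril swarm as in stub 3 ⇒ a decomposition `d'` (same number of holes) of some
`O' ⊇ O` satisfying all five T2 clauses (thin, translate roots to level `τ₀`, glue into the flat chart;
root cofinality gives the covering clauses, the shadow clause gives `RaysStayInClosure O'`). -/
theorem stub_swarmGrafting : ∀ (X : Type) [TopologicalSpace X] [ChartedSpace E3 X] [IsManifold (𝓡 3) ((⊤ : ℕ∞) : WithTop ℕ∞) X] [T2Space X] [SecondCountableTopology X] [ConnectedSpace X], ∀ (D : InitialDataSet (𝓡 3) X) (𝒟 : VacuumCauchyDevelopment D), ∀ (O : Set 𝒟.carrier) (d : FinalStateDecomposition 𝒟.toSpacetime O 2), (∀ i, Kerr.IsSubextremal (d.mass i) (d.spin i)) → O = Summit.FinalStateConjecture.exteriorOf 𝒟.toCauchyDevelopment d.charted → Summit.FinalStateConjecture.HasExhaustiveCharts d → Summit.FinalStateConjecture.IsFutureOriented d → ∀ (c : E4) (w : ℝ), 0 <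 w → Disjoint {x : E4 | d.τ₀ - 1 < x 0 ∧ E4.spatialNorm (x - c) < w} (d.flatDomain : Set E4) → ∀ (h : ℕ → ℝ) (δ : ℕ → ENNReal) (Q : ℕ → TopologicalSpace.Opens E4) (Φ : ∀ j, Q j → 𝒟.carrier), (∀ j, (Q j : Set E4) = {x : E4 | -1 < x 0 ∧ x 0 < h j ∧ E4.spatialNorm x < 1}) → Filter.Tendsto h Filter.atTop Filter.atTop → Filter.Tendsto δ Filter.atTop (nhds 0) → (∀ j, ContMDiff 𝓘(ℝ, E4) (𝓡 4) ((⊤ : ℕ∞) : WithTop ℕ∞) (Φ j) ∧ Topology.IsOpenEmbedding (Φ j)) → (∀ j, Set.range (Φ j) ⊆ 𝒟.metric.causalFuture 𝒟.timeOrientation (Set.range 𝒟.embed)) → (∀ j (τ : ℝ), 𝒟.toSpacetime.deviationCk (Minkowski.backgroundOn (Q j)) (Φ j) 2 τ ≤ δ j) → (∀ j (x : Q j) (V : E4), 2 * E4.spatialNorm V ≤ V 0 → 0 < V 0 → 𝒟.timeOrientation.IsFutureDirected (mfderiv 𝓘(ℝ, E4) (𝓡 4) (Φ j) x V)) → (∀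 j (x y : Q j), 2 * E4.spatialNorm (y.1 - x.1) < y.1 0 - x.1 0 → Φ j y ∈ 𝒟.metric.chronologicalFuture 𝒟.timeOrientation {Φ j x}) → Pairwise (Function.onFun Disjoint fun j => Set.range (Φ j)) → (∀ j, Disjoint (Set.range (Φ j)) d.radiationZone) → (∀ w ∈ 𝒟.metric.chronologicalPast 𝒟.timeOrientation (⋃ j, Set.range (Φ j)), ∀ j₀ : ℕ, ∃ j, j₀ ≤ j ∧ w ∈ 𝒟.metric.causalPast 𝒟.timeOrientation (Φ j '' {x | x.1 = 0})) → (∀ [𝒟.metric.HasLeviCivita], ∀ (p : X) (γ : ℝ → 𝒟.carrier) (dom : Set ℝ), 𝒟.metric.IsNormalisedNullRayFrom 𝒟.timeOrientation 𝒟.embed 𝒟.normal p γ dom → ¬ BddAbove dom → ∀ t ∈ dom, ∃ t' ∈ dom, t ≤ t' ∧ γ t' ∈ closure (Summit.FinalStateConjecture.exteriorOf 𝒟.toCauchyDevelopment (d.charted ∪ ⋃ j, Set.range (Φ j)))) → ∃ (O' : Set 𝒟.carrier) (d' : FinalStateDecomposition 𝒟.toSpacetime O' 2), O ⊆ O' ∧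 d'.N = d.N ∧ (∀ i, Kerr.IsSubextremal (d'.mass i) (d'.spin i)) ∧ O' = Summit.FinalStateConjecture.exteriorOf 𝒟.toCauchyDevelopment d'.charted ∧ Summit.FinalStateConjecture.RaysStayInClosure 𝒟.toCauchyDevelopment O' ∧ Summit.FinalStateConjecture.HasExhaustiveCharts d' ∧ Summit.FinalStateConjecture.IsFutureOriented d' := by
  sorry

/-! Consistency (elaborated, not kept in the environment). -/
example : Goal.stub_leavesAreSound := stub_leavesAreSound
example : Goal.stub_soundExteriorCaptureWithRoom := stub_soundExteriorCaptureWithRoom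
example : Goal.stub_completeRaysShadowed := stub_completeRaysShadowed
example : Goal.stub_swarmGrafting := stub_swarmGrafting

/-! ## A causal lemma (sorry-free): rays cofinally SUB-CHARTED stay in `closure O` -/

/-- Variant of the landed `Theorems.BartnikGapSettling.SettledCapture.stub_visibleRaysStay` (p149576) with
target `closure O` in place of `closure d.charted`: with `O = exteriorOf 𝒟 U = J⁺(ι X) ∩ I⁻(U)`, a point
`γ t`, `t ≥ 0`, of a normalised null ray from `Σ` which at some later parameter `t' ≥ t` lies in
`closure O` is itself in `closure O` (`O ⊆ I⁻(U)`, a past set; push-up along the ray,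
`EndVisible.mem_closure_of_le_of_isPastSet`; openness of `I⁺(ι X)`,
`EndVisible.mem_closure_inter_causalFuture_of_pos`; right-continuity of the ray at `t = 0`).
[cite: ONeillSemiRiemannian1983, Ch. 14, Cor. 14.1 (p. 402)] -/
theorem raysStay_of_le_of_mem_closure {X : Type} [TopologicalSpace X] [ChartedSpace E3 X]
    [IsManifold (𝓡 3) ((⊤ : ℕ∞) : WithTop ℕ∞) X] [ConnectedSpace X] {D : InitialDataSet (𝓡 3) X}
    (𝒟 : VacuumCauchyDevelopment D) (O U : Set 𝒟.carrier)
    (hO : O = Summit.FinalStateConjecture.exteriorOf 𝒟.toCauchyDevelopment U) [𝒟.metric.HasLeviCivita]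
    {p : X} {γ : ℝ → 𝒟.carrier} {dom : Set ℝ}
    (hγ : 𝒟.metric.IsNormalisedNullRayFrom 𝒟.timeOrientation 𝒟.embed 𝒟.normal p γ dom)
    {t t' : ℝ} (ht : t ∈ dom) (ht' : t' ∈ dom) (h0 : 0 ≤ t) (htt' : t ≤ t') (hvis : γ t' ∈ closure O) :
    γ t ∈ closure O := by
  -- `I⁻(U)` is a past set containing `O`
  have hP : 𝒟.metric.IsPastSet 𝒟.timeOrientation (𝒟.metric.chronologicalPast 𝒟.timeOrientation U) :=
    LorentzianMetric.isPastSet_chronologicalPast U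
  have hOsub : O ⊆ 𝒟.metric.chronologicalPast 𝒟.timeOrientation U := by
    rw [hO]
    exact inter_subset_right
  have hcl : γ t' ∈ closure (𝒟.metric.chronologicalPast 𝒟.timeOrientation U) :=
    closure_mono hOsub hvis
  -- push-up: every earlier ray point lies in `closure I⁻(U)`
  have hall : ∀ s ∈ dom, s ≤ t' → γ s ∈ closure (𝒟.metric.chronologicalPast 𝒟.timeOrientation U) :=
    fun s hs hst' ↦ EndVisible.mem_closure_of_le_of_isPastSet hP hγ hs ht' hst' hcl
  -- positive parameters: intersect with the open `I⁺(ι X) ⊆ J⁺(ι X)`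
  have hpos : ∀ s ∈ dom, 0 < s → s ≤ t' → γ s ∈ closure O := by
    intro s hs hs0 hst'
    have h1 := EndVisible.mem_closure_inter_causalFuture_of_pos hγ hs hs0 (hall s hs hst')
    rw [hO]
    unfold Summit.FinalStateConjecture.exteriorOf
    rwa [inter_comm] at h1
  rcases h0.eq_or_lt with rfl | ht0
  · rcases htt'.eq_or_lt with rfl | ht'0
    · exact hvis
    · -- `t = 0 < t'`: `γ 0 = lim_{s ↓ 0} γ s` with `γ s ∈ closure O` for `0 < s < t'`
      have hc : Tendsto γ (𝓝[>] 0) (𝓝 (γ 0)) :=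
        (EndVisible.continuousAt_of_isNormalisedNullRayFrom hγ hγ.zero_mem).tendsto.mono_left
          nhdsWithin_le_nhds
      have hev : ∀ᶠ s in 𝓝[>] (0 : ℝ), γ s ∈ closure O := by
        filter_upwards [Ioo_mem_nhdsGT ht'0] with s hs
        exact hpos s (hγ.isMaximalGeodesicOn.2.1.out hγ.zero_mem ht' ⟨hs.1.le, hs.2.le⟩) hs.1 hs.2.le
      have h := mem_closure_of_tendsto hc hev
      rwa [closure_closure] at h
  · exact hpos t ht ht0 htt'

/-! ## The composition (kernel-checked; no `sorry` of its own) -/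

/-- THE CRUX BY NAME from the four stubs: stub 1 upgrades the typed leaves to sound ones, stub 2 gives
`(O, d)`; if its rays are cofinally sub-charted, `raysStay_of_le_of_mem_closure` gives
`RaysStayInClosure 𝒟 O` and `(O, d)` itself witnesses the T2 conclusion; otherwise stub 2 leaves room and
stub 3 either certifies the rays of `(O, d)` directly (same lemma) or supplies a tendril swarm, which stub 4
grafts into a witness `(O', d')` of all five clauses. -/
theorem SettledCapture_of :
    Goal.stub_leavesAreSound → Goal.stub_soundExteriorCaptureWithRoom → Goal.stub_completeRaysShadowed →
      Goal.stub_swarmGrafting →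
        Summit.FinalStateConjecture.FinalStateConjecture.Theses.BartnikGapSettling.SettledCapture := by
  intro h₀ h₁ h₃ h₂ X _ _ _ _ _ _ D hD 𝒟 hmax hscri hleaf
  have hsound : SoundLeafHyp 𝒟 := h₀ X D hD 𝒟 hmax hscri hleaf
  obtain ⟨O, d, hsub, hO, hexh, hfut, hvr⟩ := h₁ X D hD 𝒟 hmax hscri hsound
  rcases hvr with hvis | ⟨c, w, hw, hroom⟩
  · refine ⟨O, d, hsub, hO, ?_, hexh, hfut⟩
    intro inst p γ dom hγ hdom t ht h0
    obtain ⟨t', ht', htt', hv⟩ := hvis p γ dom hγ hdom t ht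
    exact raysStay_of_le_of_mem_closure 𝒟 O d.charted hO hγ ht ht' h0 htt' hv
  · rcases h₃ X D hD 𝒟 hmax hscri O d hsub hO hexh hfut with
      hshadow | ⟨h, δ, Q, Φ, hQ, hh, hδ, hsm, hJ, hdev, hor, hchr, hdis, hrad, hcof, hray⟩
    · refine ⟨O, d, hsub, hO, ?_, hexh, hfut⟩
      intro inst p γ dom hγ hdom t ht h0
      obtain ⟨t', ht', htt', hv⟩ := hshadow p γ dom hγ hdom t ht
      exact raysStay_of_le_of_mem_closure 𝒟 O d.charted hO hγ ht ht' h0 htt' hv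
    · obtain ⟨O', d', -, -, hsub', hO', hrays', hexh', hfut'⟩ :=
        h₂ X D 𝒟 O d hsub hO hexh hfut c w hw hroom h δ Q Φ hQ hh hδ hsm hJ hdev hor hchr hdis hrad hcof hray
      exact ⟨O', d', hsub', hO', hrays', hexh', hfut'⟩

/-! ## Transfer to the re-typed item (kernel-checked): the same three leaf-free / sound stubs close
`SoundSettledCapture` (`Negative/SoundRetype.lean`, p153807) WITHOUT stub 1 (`stub_leavesAreSound`) -/

/-- The RE-TYPED crux from stubs 2, 3, 4 alone: under the sound re-type the hypothesis IS `SoundLeafHyp 𝒟`,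
so `stub_leavesAreSound` (the isolated misstatement) drops out and nothing else changes; conversely the
typed crux follows from `stub_leavesAreSound` and `SoundSettledCapture` by `settledCapture_iff` /
`soundSettledCapture_iff` (one line, not stated here: the skeleton audit wants ONE theorem concluding the
crux by name in this file). -/
theorem SoundSettledCapture_of :
    Goal.stub_soundExteriorCaptureWithRoom → Goal.stub_completeRaysShadowed → Goal.stub_swarmGrafting →
      SoundSettledCapture := by
  intro h₁ h₃ h₂ X _ _ _ _ _ _ D hD 𝒟 hmax hscri hsound
  obtain ⟨O, d, hsub, hO, hexh, hfut, hvr⟩ := h₁ X D hD 𝒟 hmax hscri hsound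
  rcases hvr with hvis | ⟨c, w, hw, hroom⟩
  · refine ⟨O, d, hsub, hO, ?_, hexh, hfut⟩
    intro inst p γ dom hγ hdom t ht h0
    obtain ⟨t', ht', htt', hv⟩ := hvis p γ dom hγ hdom t ht
    exact raysStay_of_le_of_mem_closure 𝒟 O d.charted hO hγ ht ht' h0 htt' hv
  · rcases h₃ X D hD 𝒟 hmax hscri O d hsub hO hexh hfut with
      hshadow | ⟨h, δ, Q, Φ, hQ, hh, hδ, hsm, hJ, hdev, hor, hchr, hdis, hrad, hcof, hray⟩
    · refine ⟨O, d, hsub, hO, ?_, hexh, hfut⟩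
      intro inst p γ dom hγ hdom t ht h0
      obtain ⟨t', ht', htt', hv⟩ := hshadow p γ dom hγ hdom t ht
      exact raysStay_of_le_of_mem_closure 𝒟 O d.charted hO hγ ht ht' h0 htt' hv
    · obtain ⟨O', d', -, -, hsub', hO', hrays', hexh', hfut'⟩ :=
        h₂ X D 𝒟 O d hsub hO hexh hfut c w hw hroom h δ Q Φ hQ hh hδ hsm hJ hdev hor hchr hdis hrad hcof hray
      exact ⟨O', d', hsub', hO', hrays', hexh', hfut'⟩

end Summit.FinalStateConjecture.FinalStateConjecture.Cruxes.SettledCapture.TendrilSwarmRays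

end
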